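import Summits.BirchSwinnertonDyer.BirchSwinnertonDyer.Theses.UniversalToricDescent
import HarnessLib
import Mathlib.RingTheory.PowerSeries.WeierstrassPreparation
import Mathlib.LinearAlgebra.Finsupp.LinearCombination

/-!
# NODE (D-0171) — crux idea `dense-divisibility-closure` on `RationalSplitIMCInclusionAtThree`
# (stmt-BirchSwinnertonDyer-24207, route UniversalToricDescent, the RATIONAL WALL; crux-ideate standing cover g21, 2026-08-31)

Compiles (`lean check` rc 0, 0 sorry, no banned option). KERNEL theorem
`rationalSplitIMCInclusionAtThree_of_denseDivisibilityClosure : P_FERN → P_MU → P_INCL → P_ALG → P_AN → crux` (BY NAME),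
factored through the PROVED algebraic lever of §A (`dvd_of_forall_exists_coeff_sub_mul_mem`: over a complete local ring,
divisibility by a μ = 0 series is a ZARISKI-CLOSED condition on the base) and the node statement U = `UniversalDivisibilityAtThree`
(`…_of_universalDivisibility : U → P_ALG → P_AN → crux`, `universalDivisibility_of_fern : P_FERN → P_MU → P_INCL → U`,
converse `fernInclusions_of_universalDivisibility : U → P_INCL`). Nothing here proves the crux, the wall, or BSD.

## KEEP / KILL (g21) — every live idea re-read against instrument / vet output since g20 (13:28Z): NO new vet, triage,
Disproof.lean, Negative/ or director line names a 24207 idea; «COVER CLOSED 24207» absent; acq-15034 (Castella JLMS 2017, g20 F1)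
still OPEN ⇒ the g20 table STANDS unchanged: KEEP g0 eisenstein-kato-swap · base-doubling-tau-signs · g2 adic-congruence-ladder ·
g3 nonsplit-patching-saturation · g5 bounded-resolvent-twist-door · g6 root-trichotomy-rank-cap · g7 endoscopic-accumulating-reciprocity ·
g8 derived-antidiagonal-content-bound · g9 frozen-channel-padic-pin · g10 torsion-anchored-reciprocity · g11 cubic-taming-descent ·
g12 layer-cake-sublinear-slack · g13 untamed-cubic-host-gcd · g14 eisenstein-orbit-amplification · g15 psi-zero-honda-frame ·
g16 different-matched-layer-fitting · g17 yoshida-spectator-carrier · g18 zeta-integrality-core-split · g19 disc-exact-crystalline-teeth ·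
g20 sign-line-tangency; KILLED (unchanged): universal-toric-half-order, germ-recentred-tempered-heegner, tempered-eisenstein,
GU(2,1)-as-supply; payload dead lines 24208 kernel_rat RK-6 v2, 24209, RK-7 v1.

## THE IDEA (technique class: deformation-theoretic transport · Weierstrass preparation · Zariski density of modular points)
LEVER = CLOSEDNESS OF THE DIVISIBILITY LOCUS.  Let `A` be (the reduced, `𝓞`-flat quotient of the irreducible component through
`f_E` of) the universal deformation ring `R(ρ̄_{E,3})` (complete local Noetherian), `F ∈ A⟦T⟧` the characteristic series of the
TYPE-BLIND family Selmer module `X_𝔛 = X_(∅,0)(𝕋_𝔛 ⊗ Λ_ac)` (relaxed at `𝔭`, strict at `𝔭′` needs no local filtration, so it is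
defined over the WHOLE universal family, supercuspidal point included) and `G ∈ A⟦T⟧` the universal BDP function
(Loeffler arXiv:2003.13738 §5.4; Hao–Loeffler arXiv:2405.12611).  Weierstrass-divide `G = Q·F + Rem`, `Rem ∈ A[T]`, `deg Rem < λ̄`
(possible iff `F mod 𝔪_A ≠ 0`, i.e. μ = 0 — the route's sibling crux `TwinAlgMuZeroAtThree` read at the twin point).  At a point
`𝔮 ∈ Spec A`, `F_𝔮 ∣ G_𝔮` in `(A/𝔮)⟦T⟧` ⟺ `Rem ≡ 0 (mod 𝔮)` (uniqueness of Weierstrass division over `A/𝔮`).  HENCE THE SET OF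
POINTS WHERE THE KOLYVAGIN-DIRECTION INCLUSION HOLDS IS `V(coefficients of Rem)`: ZARISKI-CLOSED.  The infinite fern
(Gouvêa–Mazur, Böckle, Emerton; Kisin's local version [corpus:paper:anon2010-deformations-gqp-gl2-qp-representations p.3, Thm 0.3,
p > 2]) makes CRYSTALLINE modular points of prime-to-3 level Zariski-dense; at each of them the form is GOOD at 3 and every engine
that is dead for `f_E` (Heegner classes with norm relations, BDP formula, BF/Coleman families) is alive, so the RATIONAL BDP-IMC
inclusion there is classical technology (any point-dependent 3-power slack is harmless: `3 ∤ F_𝔮` by μ = 0).  Density ⇒ `Rem = 0`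
⇒ `F ∣ G` in `A⟦T⟧` (U) ⇒ specialise at `𝔮_f` (EASY control direction only: Fitting functoriality puts `φ(F)` INSIDE
`Ch_Λ(X_(∅,0))·R₀′⟦T⟧` up to the common imprimitivity factor `P`) ⇒ `∃ k, 3^k·L ∈ Ch·R₀′⟦T⟧` = the crux.
NO Euler system, NO explicit reciprocity law and NO p-adic Hodge theory is ever invoked AT the wild supercuspidal point.

«WHY NOVEL» (vs every KEEP card, the LEAD line and the route's own transport): the route/Fouquet (arXiv:2501.07105 Thm 1.7) and
CKL17 (arXiv:1504.06310) / Ochiai 2006 Cor 2.7 [corpus:paper:ochiai2006-two-variable-iwasawa-main-conjecture p.8] propagate the IMC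
between points of a family ONLY in the presence of a FAMILY-LEVEL one-sided inclusion coming from a FAMILY Euler system (universal
zeta element = the wall itself; big Heegner points; Beilinson–Kato) and move EQUALITY via λ/μ-constancy (GV/EPW, the route's
`DefectTransportModThreePT`): counts, never root locations.  g2 `adic-congruence-ladder` approximates `f_E` 3-ADICALLY by congruent
forms `g_m` (depth `3^m`, weights → ∞, Krull closedness in `R₀⟦T⟧`) and needs a UNIFORM slack along forms converging to the
supercuspidal point; the desk card `fern-reciprocity` (utd-idea g41) uses fern density only to transport an ANALYTIC IDENTITY (the ERL)
and still needs a universal BF class.  Here the transported object is a ONE-SIDED DIVISIBILITY of the ALGEBRAIC characteristic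
series (root locations included), the closure is ZARISKI (polynomial identities `Rem = 0` on `Spec A`, any dense set, no metric
approximation of `f_E`, no uniformity), and no Euler class over the family or at `f_E` is required — the Euler systems live one
at a time at good crystalline points.  Searches: corpus «Zariski density modular points universal deformation infinite fern»
→ [corpus:book:cornell1997-modular-forms-fermats-last-theorem p.378 (Mazur [M3] "infinite fern")], [corpus:paper:anon2010-… p.3];
«Ochiai two-variable main conjecture specializations» → [corpus:paper:ochiai2006-… p.8 Cor 2.7, p.31 Lemma 7.2]; galaxy
«density of modular points|infinite fern» → [galaxy:panama:506015866945592] (CSS book), «specialization of the characteristic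
ideal|characteristic ideal commutes» → [galaxy:panama:339164977430610] (Hida, Elementary Modular Iwasawa Theory); no hit in corpus
(fts+vec) or galaxy for a DENSITY ⇒ DIVISIBILITY transport without a family Euler system («divisibility Zariski closed Weierstrass
remainder family», «main conjecture dense set of points implies family»).

## PIECES (tags per D-0171; `𝔉` = the frame selector: per row a complete local Noetherian carrier `A`, points `𝔮 : ι → Ideal A`,
## series `F G : A⟦T⟧`, the `f`-specialisation `φ : A⟦T⟧ →+* R₀′⟦T⟧` and the common imprimitivity factor `P ∈ R₀′⟦T⟧`)
* P_FERN `FernDensityAtThree`  [WEAKER · ATTACKABLE (cite-level) / INSTRUMENTABLE]: `⋂ i, 𝔮 i = 0` — INTENDED: crystalline modular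
  points of level `N₀ = N/3^{v₃(N)}` are Zariski-dense in the component of `Spec R(ρ̄_{E,3})` through `f_E` (GM/Böckle/Emerton; local:
  Kisin Thm 0.3, p > 2).  Leaf asks: Böckle's hypotheses for `ρ̄ = E[3]` onto `GL₂(𝔽₃)`, `ρ̄|G_ℚ₃` irreducible; obstruction
  `H²(G_{ℚ,S}, ad ρ̄)` at p = 3 (component bookkeeping if obstructed) — INSTRUMENT ASK I-g21-1.
* P_MU `FamilyMuZeroAtThree`  [WEAKER · ATTACKABLE given control]: `F mod 𝔪_A ≠ 0` ⟸ μ(X^{Σ}_(∅,0)) = 0 at ONE classical point +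
  exact control there; the twin `E′` (`E[3] ≅ E′[3]`, good/multiplicative at 3) IS a classical point of `R(ρ̄)`: sibling crux
  `TwinAlgMuZeroAtThree` (stmt-24737) read in the family.  Necessary for the lever: without it the locus is NOT closed
  (witness `F = 3 + x`, `G = x` over `𝓞⟦x⟧`: `F_𝔮 ∣ G_𝔮` at every `x = 3^n`, `n ≥ 2`, yet `F ∤ G`).
* P_INCL `FernInclusionsAtThree`  [UNDECIDED · the research leaf — IDEA-NEEDED at p = 3 / print-grade at p ≥ 5; COSTUME iff the point
  set is shrunk to `{𝔮_f}`]: for every fern point `i`, `F ∣ G (mod 𝔮 i)`, i.e. (exact control of `X_𝔛` and interpolation of `G` at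
  `𝔮 i`) ∘ (RATIONAL Kolyvagin-direction BDP-(∅,0) IMC for the crystalline newform `g_i` of level `N₀`, `ρ̄_{g_i} ≅ E[3]`, ANY weight
  and slope, p = 3 split in `K`).  Print: weight 2 ordinary p ≥ 5 (Howard/Castella–Hsieh/BCK arXiv:1810.xxxx «p > 3»), higher
  weight via Heegner cycles (Castella–Hsieh Math. Ann. 2018; Castella [corpus:paper:doi-10-1007-s00208-012-0871-4]), non-ordinary
  weight 2 (Castella–Wan, Kobayashi–Ota); the p = 3 ports and non-ordinary HIGH weight are open but CLASSICAL (every engine exists at a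
  good prime) — this is where the crux's difficulty is moved, from ONE point with no engine to a DENSE SET of points with engines.
  Density forces non-ordinary points of unbounded weight (the nearly-ordinary locus has dimension 2 < 3): BARRIER-ish sub-leaf B-g21-1.
* P_ALG `AlgebraicSpecializationAtThree`  [UNDECIDED · ATTACKABLE (M)]: `φ(F) = c·P` with `c ∈ Ch_Λ(X_(∅,0))·R₀′⟦T⟧` — the EASY
  direction of control at `𝔮_f` (Fitting ideals base-change and grow under the surjection `X_𝔛 ⊗ κ(𝔮_f) ↠ X^{Σ}_(∅,0)(E/K_∞)`;
  `Fitt ⊆ Ch`; `P = ∏_{ℓ ∈ Σ∖3} P_ℓ(T)` the imprimitivity factor; needs `X_𝔛` of projective dimension ≤ 1 after pseudo-null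
  quotient — Ochiai Lemma 7.2-type [corpus:paper:ochiai2006-… p.31]).
* P_AN `AnalyticSpecializationAtThree`  [UNDECIDED · IDEA-NEEDED (typing of `G`)]: `P ≠ 0` and `φ(G) = u·3^k·L·P`, `u` a unit — the
  universal BDP function specialises at `𝔮_f` to the handed frame `L` up to unit and 3-power (frame rigidity: tree
  `…RatwallThinComb.ContRigidityUpTo.eq_zero_or_rel_spec_of_toricUpTo_values`; route LINE text Loeffler §5.4 / Hao–Loeffler Thm 3.5).
* U `UniversalDivisibilityAtThree`  [node statement; STRONGER in content than the crux (it is the inclusion for the whole family),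
  EQUIVALENT to P_INCL given P_FERN + P_MU (both directions proved below) — an IMPLIED-BY node, no child route (no_new_routes)].

## LEAVES: P_FERN — ATTACKABLE/INSTRUMENTABLE (I-g21-1: per SCu row, is `ρ̄_{E,3}` unobstructed? `H⁰(G_ℚ₃, ad⁰ρ̄(1))`, class-group
term); P_MU — ATTACKABLE (⟸ stmt-24737 + control at the twin point); P_INCL — IDEA-NEEDED (p = 3, non-ordinary high weight BDP-IMC
inclusion; sub-leaf B-g21-1 BARRIER-ish: no dense set avoids infinite-slope-type points? — NO: crystalline points have FINITE slope; the
fern is dense WITHOUT any supercuspidal point, which is the whole point); P_ALG — ATTACKABLE (M, commutative algebra + control);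
P_AN — IDEA-NEEDED (definition request `UniversalDeformationRing` / universal BDP function typing, route §Definition requests).
CHEAPEST FALSIFIER: (F-g21-1) does Böckle/GM density hold for `ρ̄ = E[3]|G_ℚ` with `ρ̄|G_ℚ₃` irreducible at p = 3 on the component of
`f_E`? (literature check; if the component through a potentially-supercuspidal point provably contains NO crystalline point the card
dies) · (F-g21-2) is `X_(∅,0)` over the universal family a TORSION `A⟦T⟧`-module with exact control at crystalline points (rank
count: relaxed⊕strict has Euler characteristic 0 over `K` — yes on paper)?
Disproof used: none on file for 24207 (`ledger crux ls`: no Disproof.lean / Negative/); negatives index {15532, 24881} disjoint.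
-/

set_option autoImplicit false
set_option linter.dupNamespace false

noncomputable section

open scoped Classical

namespace Summit.BirchSwinnertonDyer.BirchSwinnertonDyer.Cruxes.RationalSplitIMCInclusionAtThree.DenseDivisibilityClosure

/-! ## §A  Algebra (PROVED): the divisibility locus of a μ = 0 series is Zariski-closed. -/
section Algebra

open PowerSeries

variable {A : Type*} [CommRing A]

/-- A series all of whose coefficients lie in the span of a finite set `s` is a finite `s`-combination of series. -/
theorem exists_sum_smul_eq_of_forall_coeff_mem {𝔮 : Ideal A} {s : Finset A} (hs : Ideal.span (s : Set A) = 𝔮)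
    (E : A⟦X⟧) (hE : ∀ k, coeff k E ∈ 𝔮) :
    ∃ c : A → A⟦X⟧, E = ∑ a ∈ s, a • c a := by
  classical
  have hc : ∀ k, ∃ c : A → A, ∑ a ∈ s, c a * a = coeff k E := by
    intro k
    have hk : coeff k E ∈ Ideal.span (s : Set A) := hs ▸ hE k
    obtain ⟨c, -, hc⟩ := Submodule.mem_span_finset.mp hk
    exact ⟨c, by simpa [smul_eq_mul] using hc⟩
  choose c hc using hc
  refine ⟨fun a => PowerSeries.mk fun k => c k a, ?_⟩
  ext k
  simp only [map_sum, coeff_smul, coeff_mk, smul_eq_mul]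
  rw [← hc k]
  exact Finset.sum_congr rfl fun a _ => mul_comm _ _

/-- `%ʷ` is additive in the dividend over finite sums of scalar multiples. -/
theorem sum_smul_weierstrassMod [IsLocalRing A] [IsAdicComplete (IsLocalRing.maximalIdeal A) A]
    {β : Type*} (s : Finset β) (b : β → A) (c : β → A⟦X⟧) (F : A⟦X⟧) :
    (∑ x ∈ s, b x • c x) %ʷ F = ∑ x ∈ s, b x • (c x %ʷ F) := by
  classical
  induction s using Finset.induction_on with
  | empty => simp
  | insert a t hat ih => rw [Finset.sum_insert hat, Finset.sum_insert hat, add_weierstrassMod, smul_weierstrassMod, ih]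

/-- **Coefficients of a Weierstrass remainder.** If every coefficient of `E` lies in a finitely generated ideal `𝔮`,
so does every coefficient of the Weierstrass remainder `E %ʷ F`. -/
theorem coeff_weierstrassMod_mem [IsLocalRing A] [IsAdicComplete (IsLocalRing.maximalIdeal A) A] {𝔮 : Ideal A}
    (h𝔮 : 𝔮.FG) (F E : A⟦X⟧) (hE : ∀ k, coeff k E ∈ 𝔮) (n : ℕ) : (E %ʷ F).coeff n ∈ 𝔮 := by
  classical
  obtain ⟨s, hs⟩ := h𝔮
  obtain ⟨c, rfl⟩ := exists_sum_smul_eq_of_forall_coeff_mem hs E hE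
  rw [sum_smul_weierstrassMod s (fun a => a) c F, Polynomial.finsetSum_coeff]
  refine Ideal.sum_mem _ fun a ha => ?_
  rw [Polynomial.coeff_smul, smul_eq_mul]
  exact Ideal.mul_mem_right _ _ (hs ▸ Ideal.subset_span ha)

/-- **A1 · THE LEVER (closedness of the divisibility locus).** `A` a complete local ring, `𝔮 i` finitely generated ideals
with zero intersection (a Zariski-dense family of points), `F ∈ A⟦X⟧` with nonzero reduction modulo the maximal ideal (μ = 0).
If `F̄ ∣ Ḡ` in `(A ⧸ 𝔮 i)⟦X⟧` for every `i` (coefficientwise form), then `F ∣ G` in `A⟦X⟧`.  Proof: the Weierstrass remainder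
`G %ʷ F` has coefficients in every `𝔮 i` (uniqueness of Weierstrass division), hence is `0`. -/
theorem dvd_of_forall_exists_coeff_sub_mul_mem [IsLocalRing A] [IsAdicComplete (IsLocalRing.maximalIdeal A) A]
    {ι : Sort*} (𝔮 : ι → Ideal A) (hfg : ∀ i, (𝔮 i).FG) (hdense : ∀ a : A, (∀ i, a ∈ 𝔮 i) → a = 0)
    {F G : A⟦X⟧} (hF : F.map (IsLocalRing.residue A) ≠ 0)
    (hdiv : ∀ i, ∃ S : A⟦X⟧, ∀ k, coeff k (G - F * S) ∈ 𝔮 i) : F ∣ G := by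
  have hG := G.eq_mul_weierstrassDiv_add_weierstrassMod hF
  suffices hr : G %ʷ F = 0 by
    exact ⟨G /ʷ F, by rw [hr, Polynomial.coe_zero, add_zero] at hG; exact hG⟩
  ext n
  rw [Polynomial.coeff_zero]
  refine hdense _ fun i => ?_
  obtain ⟨S, hS⟩ := hdiv i
  set E := G - F * S with hE
  have hE' := E.eq_mul_weierstrassDiv_add_weierstrassMod hF
  have hdivision : G.IsWeierstrassDivision F (S + E /ʷ F) (E %ʷ F) :=
    ⟨E.degree_weierstrassMod_lt F, by rw [mul_add, add_assoc, ← hE', hE]; ring⟩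
  obtain ⟨-, hr⟩ := hdivision.unique hF
  rw [← hr]
  exact coeff_weierstrassMod_mem (hfg i) F E hS n

/-- **A1′ · `∣` form.** Divisibility modulo every `𝔮 i` implies divisibility. -/
theorem dvd_of_forall_map_dvd [IsLocalRing A] [IsAdicComplete (IsLocalRing.maximalIdeal A) A]
    {ι : Sort*} (𝔮 : ι → Ideal A) (hfg : ∀ i, (𝔮 i).FG) (hdense : ∀ a : A, (∀ i, a ∈ 𝔮 i) → a = 0)
    {F G : A⟦X⟧} (hF : F.map (IsLocalRing.residue A) ≠ 0)
    (hdiv : ∀ i, (F.map (Ideal.Quotient.mk (𝔮 i))) ∣ (G.map (Ideal.Quotient.mk (𝔮 i)))) : F ∣ G := by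
  refine dvd_of_forall_exists_coeff_sub_mul_mem 𝔮 hfg hdense hF fun i => ?_
  obtain ⟨Sbar, hSbar⟩ := hdiv i
  obtain ⟨S, rfl⟩ := PowerSeries.map_surjective (Ideal.Quotient.mk (𝔮 i)) Ideal.Quotient.mk_surjective Sbar
  refine ⟨S, fun k => ?_⟩
  rw [← Ideal.Quotient.eq_zero_iff_mem, ← PowerSeries.coeff_map, map_sub, map_mul, ← hSbar, sub_self, map_zero]

/-- **A2 · converse (trivial): divisibility implies divisibility modulo every ideal.** Shows P_INCL ⟺ U given P_FERN + P_MU. -/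
theorem forall_exists_coeff_sub_mul_mem_of_dvd {ι : Sort*} (𝔮 : ι → Ideal A) {F G : A⟦X⟧} (h : F ∣ G) :
    ∀ i, ∃ S : A⟦X⟧, ∀ k, coeff k (G - F * S) ∈ 𝔮 i := by
  obtain ⟨Q, rfl⟩ := h
  exact fun i => ⟨Q, fun k => by simp⟩

/-- **A3 · a cheap sufficient condition for P_MU.** A series with SOME unit coefficient has nonzero reduction modulo the
maximal ideal (so `F mod 𝔪_A ≠ 0` follows from one unit coefficient, e.g. the `λ`-th one at a μ = 0 point).  (That μ = 0 is also
NECESSARY for the closedness lever is the docstring witness `F = 3 + x ∤ G = x` over `𝓞⟦x⟧`, divisible at every point `x = 3^n`,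
`n ≥ 2`.) -/
theorem residue_ne_zero_of_isUnit_coeff [IsLocalRing A] {F : A⟦X⟧} {n : ℕ} (h : IsUnit (coeff n F)) :
    F.map (IsLocalRing.residue A) ≠ 0 := by
  intro hF
  have := congrArg (coeff n) hF
  rw [coeff_map, map_zero] at this
  exact (IsLocalRing.residue_ne_zero_iff_isUnit _).mpr h this

/-- **A4 · specialisation door.** `F ∣ G` in the family, `φ(F) = c·P` with `c ∈ I`, `φ(G) = u·q^k·L·P` with `u` a unit and
`P` cancellable ⟹ `q^k·L ∈ I`. -/
theorem pow_mul_mem_of_dvd_of_specialization {B C : Type*} [CommRing B] [CommRing C] [IsDomain C] (φ : B →+* C)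
    {I : Ideal C} {F G : B} {c P L u q : C} {k : ℕ} (hFG : F ∣ G) (hc : c ∈ I) (hF : φ F = c * P) (hP : P ≠ 0)
    (hu : IsUnit u) (hG : φ G = u * q ^ k * L * P) : q ^ k * L ∈ I := by
  obtain ⟨Q, rfl⟩ := hFG
  have h1 : u * q ^ k * L * P = c * φ Q * P := by rw [← hG, map_mul, hF]; ring
  have h2 : u * q ^ k * L = c * φ Q := mul_right_cancel₀ hP h1
  obtain ⟨v, rfl⟩ := hu
  have : q ^ k * L = ↑v⁻¹ * (c * φ Q) := by
    rw [← h2, ← mul_assoc, ← mul_assoc, Units.inv_mul, one_mul]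
  rw [this]
  exact I.mul_mem_left _ (I.mul_mem_right _ hc)

end Algebra

/-! ## §B  Frame, row telescope (verbatim from g19/g20 nodes) and pieces. -/

/-- **FRAME** for one row: the universal-deformation carrier and the four family/specialisation data.  INTENDED: `A` = reduced
`𝓞`-flat quotient of the component through `f_E` of `R(ρ̄_{E,3})`; `𝔮` = the crystalline modular points of level `N₀`; `F` =
`char_{A⟦T⟧} X^{Σ}_(∅,0)(𝕋_𝔛)`; `G` = universal BDP function; `φ` = specialisation at `𝔮_f` composed with `ℤ₃ → R₀′`; `P` = the
common imprimitivity factor `∏_{ℓ∈Σ∖3} P_ℓ`. -/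
structure Frame : Type 1 where
  /-- carrier (complete local Noetherian ring) -/
  A : Type
  [instCommRing : CommRing A]
  [instLocal : IsLocalRing A]
  [instComplete : IsAdicComplete (IsLocalRing.maximalIdeal A) A]
  [instNoetherian : IsNoetherianRing A]
  /-- index of the dense point set -/
  ι : Type
  /-- the points, as ideals of `A` -/
  𝔮 : ι → Ideal A
  /-- family characteristic series -/
  F : PowerSeries A
  /-- family L-function -/
  G : PowerSeries A
  /-- specialisation at the `f`-point, landing in `R₀′⟦T⟧` -/
  φ : PowerSeries A →+* Literature.NumberTheory.EllipticCurves.UnrSeries 3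
  /-- common imprimitivity factor at the `f`-point -/
  P : Literature.NumberTheory.EllipticCurves.UnrSeries 3

attribute [instance] Frame.instCommRing Frame.instLocal Frame.instComplete Frame.instNoetherian

/-- **FRAME SELECTOR**: assigns a frame to the row data `(W, K, κ, γ, 𝔭, 𝔭′, L)`. -/
def FrameSelector : Type 1 :=
  ∀ (W : WeierstrassCurve ℚ) (K : Type) [Field K] [NumberField K],
    Literature.NumberTheory.EllipticCurves.ZpExtension K 3 → Field.absoluteGaloisGroup K →
      IsDedekindDomain.HeightOneSpectrum (NumberField.RingOfIntegers K) →
        IsDedekindDomain.HeightOneSpectrum (NumberField.RingOfIntegers K) →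
          Literature.NumberTheory.EllipticCurves.UnrSeries 3 → Frame

/-- A predicate on the row data the selectors see: `(W, K, κ, γ, 𝔭, 𝔭', L)` (g20 verbatim). -/
def RowPredicate : Type 1 :=
  ∀ (W : WeierstrassCurve ℚ) (K : Type) [Field K] [NumberField K],
    Literature.NumberTheory.EllipticCurves.ZpExtension K 3 → Field.absoluteGaloisGroup K →
      IsDedekindDomain.HeightOneSpectrum (NumberField.RingOfIntegers K) →
        IsDedekindDomain.HeightOneSpectrum (NumberField.RingOfIntegers K) →
          Literature.NumberTheory.EllipticCurves.UnrSeries 3 → Prop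

/-- `P` holds ON EVERY ROW of the crux (the binder telescope of `RationalSplitIMCInclusionAtThree`, verbatim; g20 verbatim). -/
def OnEveryRow (P : RowPredicate) : Prop :=
  ∀ (W : WeierstrassCurve ℚ) [W.IsElliptic] [W.IsGloballyMinimal] (N : ℕ) [NeZero N] (K : Type) [Field K] [NumberField K] (Dt : Literature.NumberTheory.EllipticCurves.ModularForms.ModularParametrizationData W N), Summit.BirchSwinnertonDyer.Rank1Residual.Additive.ClassO6 W 3 → W.HasSurjectiveModNGaloisRep 3 → W.analyticRank = 1 → W.conductorNorm ℤ = N → Literature.NumberTheory.EllipticCurves.IsImaginaryQuadratic K → Literature.NumberTheory.EllipticCurves.SatisfiesHeegnerHypothesis N K → ∀ (κ : Literature.NumberTheory.EllipticCurves.ZpExtension K 3), κ.IsAnticyclotomic → ∀ (γ : Field.absoluteGaloisGroup K) [Fact (κ.IsTopGenerator γ)] (𝔭 : IsDedekindDomain.HeightOneSpectrum (NumberField.RingOfIntegers K)), ((3 : ℕ) : NumberField.RingOfIntegers K) ∈ 𝔭.asIdeal → 𝔭.asIdeal.ramificationIdx (NumberField.RingOfIntegers ℚ) = 1 → 𝔭.asIdeal.inertiaDeg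 (NumberField.RingOfIntegers ℚ) = 1 → ∀ (𝔭' : IsDedekindDomain.HeightOneSpectrum (NumberField.RingOfIntegers K)), ((3 : ℕ) : NumberField.RingOfIntegers K) ∈ 𝔭'.asIdeal → 𝔭' ≠ 𝔭 → ∀ (ι' : PadicAlgCl 3 ≃+* ℂ), Summit.BirchSwinnertonDyer.BirchSwinnertonDyer.Theorems.SchneiderFree.BranchInducesPrime 3 ι' 𝔭 → ∀ (ΩK : ℂ) (Ωp : ℂ_[3]) (L : Literature.NumberTheory.EllipticCurves.UnrSeries 3), ΩK ≠ 0 → Ωp ≠ 0 → Literature.NumberTheory.EllipticCurves.IsBDPLFunction ι' 𝔭 κ γ Dt.f ΩK Ωp L →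
    P W K κ γ 𝔭 𝔭' L

/-- Monotonicity of `OnEveryRow` (rowwise implication; g20 verbatim). -/
theorem onEveryRow_mono {P Q : RowPredicate}
    (h : ∀ (W : WeierstrassCurve ℚ) (K : Type) [Field K] [NumberField K]
      (κ : Literature.NumberTheory.EllipticCurves.ZpExtension K 3) (γ : Field.absoluteGaloisGroup K)
      (𝔭 𝔭' : IsDedekindDomain.HeightOneSpectrum (NumberField.RingOfIntegers K))
      (L : Literature.NumberTheory.EllipticCurves.UnrSeries 3), P W K κ γ 𝔭 𝔭' L → Q W K κ γ 𝔭 𝔭' L)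
    (hP : OnEveryRow P) : OnEveryRow Q := by
  intro W _ _ N _ K _ _ Dt hO6 hsurj hr1 hN hK hH κ hκ γ _ 𝔭 h𝔭 he hf 𝔭' h𝔭' hne ι' hι ΩK Ωp L hΩK hΩp hL
  exact h W K κ γ 𝔭 𝔭' L (hP W N K Dt hO6 hsurj hr1 hN hK hH κ hκ γ 𝔭 h𝔭 he hf 𝔭' h𝔭' hne ι' hι ΩK Ωp L hΩK hΩp hL)

/-- Conjunction of two rowwise pieces (g20 verbatim). -/
theorem onEveryRow_and {P Q : RowPredicate} (hP : OnEveryRow P) (hQ : OnEveryRow Q) :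
    OnEveryRow (fun W K _ _ κ γ 𝔭 𝔭' L => P W K κ γ 𝔭 𝔭' L ∧ Q W K κ γ 𝔭 𝔭' L) := by
  intro W _ _ N _ K _ _ Dt hO6 hsurj hr1 hN hK hH κ hκ γ _ 𝔭 h𝔭 he hf 𝔭' h𝔭' hne ι' hι ΩK Ωp L hΩK hΩp hL
  exact ⟨hP W N K Dt hO6 hsurj hr1 hN hK hH κ hκ γ 𝔭 h𝔭 he hf 𝔭' h𝔭' hne ι' hι ΩK Ωp L hΩK hΩp hL,
    hQ W N K Dt hO6 hsurj hr1 hN hK hH κ hκ γ 𝔭 h𝔭 he hf 𝔭' h𝔭' hne ι' hι ΩK Ωp L hΩK hΩp hL⟩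

/-! ### §B.1  The five pieces and the node statement U. -/

/-- **(P_FERN) ZARISKI DENSITY OF THE POINT SET** [WEAKER · ATTACKABLE/INSTRUMENTABLE]: on every row, `⋂ i, 𝔮 i = 0` in the
carrier — INTENDED: the infinite fern (crystalline modular points of level `N₀`) is Zariski-dense in the component through `f_E`. -/
def FernDensityAtThree (𝔉 : FrameSelector) : Prop :=
  OnEveryRow fun W K _ _ κ γ 𝔭 𝔭' L => ∀ a : (𝔉 W K κ γ 𝔭 𝔭' L).A, (∀ i, a ∈ (𝔉 W K κ γ 𝔭 𝔭' L).𝔮 i) → a = 0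

/-- **(P_MU) FAMILY μ = 0** [WEAKER · ATTACKABLE given control; sibling crux `TwinAlgMuZeroAtThree` at the twin point]: on every
row, `F mod 𝔪_A ≠ 0`. -/
def FamilyMuZeroAtThree (𝔉 : FrameSelector) : Prop :=
  OnEveryRow fun W K _ _ κ γ 𝔭 𝔭' L =>
    ((𝔉 W K κ γ 𝔭 𝔭' L).F).map (IsLocalRing.residue (𝔉 W K κ γ 𝔭 𝔭' L).A) ≠ 0

/-- **(P_INCL) INCLUSIONS ON THE DENSE SET** [UNDECIDED · the research leaf (IDEA-NEEDED at p = 3); COSTUME iff the point set is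
`{𝔮_f}`]: on every row and at every point `i`, `F ∣ G (mod 𝔮 i)` — INTENDED: exact control + rational BDP-(∅,0)-IMC inclusion for
the crystalline newform `g_i`. -/
def FernInclusionsAtThree (𝔉 : FrameSelector) : Prop :=
  OnEveryRow fun W K _ _ κ γ 𝔭 𝔭' L =>
    ∀ i, ∃ S : PowerSeries (𝔉 W K κ γ 𝔭 𝔭' L).A,
      ∀ k, PowerSeries.coeff k ((𝔉 W K κ γ 𝔭 𝔭' L).G - (𝔉 W K κ γ 𝔭 𝔭' L).F * S) ∈ (𝔉 W K κ γ 𝔭 𝔭' L).𝔮 i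

/-- **(U) UNIVERSAL DIVISIBILITY** [node statement: `F ∣ G` in `A⟦T⟧` — the Kolyvagin-direction inclusion for the whole
deformation family; ⟺ P_INCL given P_FERN + P_MU]. -/
def UniversalDivisibilityAtThree (𝔉 : FrameSelector) : Prop :=
  OnEveryRow fun W K _ _ κ γ 𝔭 𝔭' L => (𝔉 W K κ γ 𝔭 𝔭' L).F ∣ (𝔉 W K κ γ 𝔭 𝔭' L).G

/-- **(P_ALG) ALGEBRAIC SPECIALISATION AT `f`** [UNDECIDED · ATTACKABLE (M)] (full telescope, since the characteristic ideal
needs the row's `Fact (κ.IsTopGenerator γ)`): on every row, `φ(F) = c·P` for some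
`c ∈ Ch_Λ(X_(∅,0))·R₀′⟦T⟧` (easy control direction via Fitting ideals; `P` the imprimitivity factor). -/
def AlgebraicSpecializationAtThree (𝔉 : FrameSelector) : Prop :=
  ∀ (W : WeierstrassCurve ℚ) [W.IsElliptic] [W.IsGloballyMinimal] (N : ℕ) [NeZero N] (K : Type) [Field K] [NumberField K] (Dt : Literature.NumberTheory.EllipticCurves.ModularForms.ModularParametrizationData W N), Summit.BirchSwinnertonDyer.Rank1Residual.Additive.ClassO6 W 3 → W.HasSurjectiveModNGaloisRep 3 → W.analyticRank = 1 → W.conductorNorm ℤ = N → Literature.NumberTheory.EllipticCurves.IsImaginaryQuadratic K → Literature.NumberTheory.EllipticCurves.SatisfiesHeegnerHypothesis N K → ∀ (κ : Literature.NumberTheory.EllipticCurves.ZpExtension K 3), κ.IsAnticyclotomic → ∀ (γ : Field.absoluteGaloisGroup K) [Fact (κ.IsTopGenerator γ)] (𝔭 : IsDedekindDomain.HeightOneSpectrum (NumberField.RingOfIntegers K)), ((3 : ℕ) : NumberField.RingOfIntegers K) ∈ 𝔭.asIdeal → 𝔭.asIdeal.ramificationIdx (NumberField.RingOfIntegers ℚ)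 = 1 → 𝔭.asIdeal.inertiaDeg (NumberField.RingOfIntegers ℚ) = 1 → ∀ (𝔭' : IsDedekindDomain.HeightOneSpectrum (NumberField.RingOfIntegers K)), ((3 : ℕ) : NumberField.RingOfIntegers K) ∈ 𝔭'.asIdeal → 𝔭' ≠ 𝔭 → ∀ (ι' : PadicAlgCl 3 ≃+* ℂ), Summit.BirchSwinnertonDyer.BirchSwinnertonDyer.Theorems.SchneiderFree.BranchInducesPrime 3 ι' 𝔭 → ∀ (ΩK : ℂ) (Ωp : ℂ_[3]) (L : Literature.NumberTheory.EllipticCurves.UnrSeries 3), ΩK ≠ 0 → Ωp ≠ 0 → Literature.NumberTheory.EllipticCurves.IsBDPLFunction ι' 𝔭 κ γ Dt.f ΩK Ωp L →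
    ∃ c : Literature.NumberTheory.EllipticCurves.UnrSeries 3,
      c ∈ (Summit.BirchSwinnertonDyer.Rank1Residual.X11b.AcSelmer.XAc.charIdeal (W.baseChange K) 3 κ 𝔭' ∅ γ).map
          (PowerSeries.map (Summit.BirchSwinnertonDyer.Rank1Residual.X11b.Halves.toUnr 3)) ∧
      (𝔉 W K κ γ 𝔭 𝔭' L).φ (𝔉 W K κ γ 𝔭 𝔭' L).F = c * (𝔉 W K κ γ 𝔭 𝔭' L).P

/-- **(P_AN) ANALYTIC SPECIALISATION AT `f`** [UNDECIDED · IDEA-NEEDED (typing of the universal BDP function)]: on every row,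
`P ≠ 0` and `φ(G) = u·3^k·L·P` with `u` a unit (interpolation at `𝔮_f` + frame rigidity). -/
def AnalyticSpecializationAtThree (𝔉 : FrameSelector) : Prop :=
  OnEveryRow fun W K _ _ κ γ 𝔭 𝔭' L =>
    (𝔉 W K κ γ 𝔭 𝔭' L).P ≠ 0 ∧
      ∃ (k : ℕ) (u : Literature.NumberTheory.EllipticCurves.UnrSeries 3), IsUnit u ∧
        (𝔉 W K κ γ 𝔭 𝔭' L).φ (𝔉 W K κ γ 𝔭 𝔭' L).G =
          u * ((3 : ℕ) : Literature.NumberTheory.EllipticCurves.UnrSeries 3) ^ k * L * (𝔉 W K κ γ 𝔭 𝔭' L).P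

/-! ## §C  Kernel theorems. -/

/-- **U ⟸ P_FERN + P_MU + P_INCL** (the lever, rowwise). -/
theorem universalDivisibility_of_fern (𝔉 : FrameSelector) (hZ : FernDensityAtThree 𝔉) (hμ : FamilyMuZeroAtThree 𝔉)
    (hD : FernInclusionsAtThree 𝔉) : UniversalDivisibilityAtThree 𝔉 := by
  intro W _ _ N _ K _ _ Dt hO6 hsurj hr1 hN hK hH κ hκ γ _ 𝔭 h𝔭 he hf 𝔭' h𝔭' hne ι' hι ΩK Ωp L hΩK hΩp hL
  have hZ' := hZ W N K Dt hO6 hsurj hr1 hN hK hH κ hκ γ 𝔭 h𝔭 he hf 𝔭' h𝔭' hne ι' hι ΩK Ωp L hΩK hΩp hL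
  have hμ' := hμ W N K Dt hO6 hsurj hr1 hN hK hH κ hκ γ 𝔭 h𝔭 he hf 𝔭' h𝔭' hne ι' hι ΩK Ωp L hΩK hΩp hL
  have hD' := hD W N K Dt hO6 hsurj hr1 hN hK hH κ hκ γ 𝔭 h𝔭 he hf 𝔭' h𝔭' hne ι' hι ΩK Ωp L hΩK hΩp hL
  exact dvd_of_forall_exists_coeff_sub_mul_mem (𝔉 W K κ γ 𝔭 𝔭' L).𝔮 (fun i => IsNoetherian.noetherian _) hZ' hμ' hD'

/-- **P_INCL ⟸ U** (converse; so U ⟺ P_INCL on top of P_FERN + P_MU: the node is an honest IMPLIED-BY node and P_INCL is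
COSTUME exactly when the point set degenerates to the `f`-point alone). -/
theorem fernInclusions_of_universalDivisibility (𝔉 : FrameSelector) (hU : UniversalDivisibilityAtThree 𝔉) :
    FernInclusionsAtThree 𝔉 := by
  intro W _ _ N _ K _ _ Dt hO6 hsurj hr1 hN hK hH κ hκ γ _ 𝔭 h𝔭 he hf 𝔭' h𝔭' hne ι' hι ΩK Ωp L hΩK hΩp hL
  exact forall_exists_coeff_sub_mul_mem_of_dvd _
    (hU W N K Dt hO6 hsurj hr1 hN hK hH κ hκ γ 𝔭 h𝔭 he hf 𝔭' h𝔭' hne ι' hι ΩK Ωp L hΩK hΩp hL)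

/-- **crux ⟸ U + P_ALG + P_AN** (specialisation at the `f`-point). -/
theorem rationalSplitIMCInclusionAtThree_of_universalDivisibility (𝔉 : FrameSelector)
    (hU : UniversalDivisibilityAtThree 𝔉) (hA : AlgebraicSpecializationAtThree 𝔉)
    (hL : AnalyticSpecializationAtThree 𝔉) :
    Summit.BirchSwinnertonDyer.BirchSwinnertonDyer.Theses.UniversalToricDescent.RationalSplitIMCInclusionAtThree := by
  intro W _ _ N _ K _ _ Dt hO6 hsurj hr1 hN hK hH κ hκ γ _ 𝔭 h𝔭 he hf 𝔭' h𝔭' hne ι' hι ΩK Ωp L hΩK hΩp hBDP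
  have hU' := hU W N K Dt hO6 hsurj hr1 hN hK hH κ hκ γ 𝔭 h𝔭 he hf 𝔭' h𝔭' hne ι' hι ΩK Ωp L hΩK hΩp hBDP
  obtain ⟨c, hc, hFc⟩ := hA W N K Dt hO6 hsurj hr1 hN hK hH κ hκ γ 𝔭 h𝔭 he hf 𝔭' h𝔭' hne ι' hι ΩK Ωp L hΩK hΩp hBDP
  obtain ⟨hP, k, u, hu, hG⟩ := hL W N K Dt hO6 hsurj hr1 hN hK hH κ hκ γ 𝔭 h𝔭 he hf 𝔭' h𝔭' hne ι' hι ΩK Ωp L hΩK hΩp hBDP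
  exact ⟨k, pow_mul_mem_of_dvd_of_specialization (𝔉 W K κ γ 𝔭 𝔭' L).φ hU' hc hFc hP hu hG⟩

/-- **KERNEL (BY NAME).** P_FERN + P_MU + P_INCL + P_ALG + P_AN ⟹ `UniversalToricDescent.RationalSplitIMCInclusionAtThree`. -/
theorem rationalSplitIMCInclusionAtThree_of_denseDivisibilityClosure (𝔉 : FrameSelector)
    (hZ : FernDensityAtThree 𝔉) (hμ : FamilyMuZeroAtThree 𝔉) (hD : FernInclusionsAtThree 𝔉)
    (hA : AlgebraicSpecializationAtThree 𝔉) (hL : AnalyticSpecializationAtThree 𝔉) :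
    Summit.BirchSwinnertonDyer.BirchSwinnertonDyer.Theses.UniversalToricDescent.RationalSplitIMCInclusionAtThree :=
  rationalSplitIMCInclusionAtThree_of_universalDivisibility 𝔉 (universalDivisibility_of_fern 𝔉 hZ hμ hD) hA hL

end Summit.BirchSwinnertonDyer.BirchSwinnertonDyer.Cruxes.RationalSplitIMCInclusionAtThree.DenseDivisibilityClosure

end
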